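import Literature.NumberTheory.Automorphic.WhittakerShiftTorus
import Literature.NumberTheory.Automorphic.TorusIntegrandThinSupport
import Literature.NumberTheory.Automorphic.UnipotentConjHaarChar
import HarnessLib

/-!
# The torus of Whittaker shifts off a finite set of places, and the dilated character

Topic `NumberTheory/Automorphic`; namespace `Literature.NumberTheory.Automorphic`. Theorems only.
Bookkeeping for the entireness of `L^S(s, π × σ)`, `π ≇ σ̃` (Mœglin–Waldspurger (1989), Appendice,
Corollaire (i)(b)), where the bad places `S` are treated by thin test functions and the places of the
different OUTSIDE `S` by Whittaker shifts (Cogdell (2004), §3.1: "we may normalise `ψ_v`"):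

* `exists_whittakerShiftTorus_outside S` — a torus element `τ = (1, τ_f) ∈ (𝔸_Kˣ)ⁿ` with last entry
  `1`, ALL consecutive ratios `τ_i τ_{i+1}⁻¹` equal to one finite idele `a_f`, trivial components at
  the places of `S` and off the different, and at every `v ∉ S` the local shape of
  `exists_whittakerShiftTorus` (`diag(τ)_v = diag(d)` with constant ratio `a_v` such that
  `ψ_{K,v}(a_v ·)` has conductor `𝒪_v`);
* `whittakerCharFun_unipotentDiagConj_of_ratio` — `ψ_N(diag(d) u diag(d)⁻¹) = (aψ)_N(u)` for a
  diagonal `d` with constant ratios `a` (the adelic form of `whittakerCharFun_diagonalGL_conj`), whence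
  the left `N(𝔸)`-equivariance of a translate `g ↦ W(diag(d) g)` for the dilated character
  `aψ = ψ(a ·)` (`translate_unipotent_mul_eq`);
* `adicComponent_mulShift_of_apply_eq_one` — `(aψ)_v = ψ_v` at a place where `a_v = 1`, and the
  transport of spread bi-equivariance (`IsSpreadWhittakerAt`) along equal local components and to
  left translates.

## References

* J. W. Cogdell, *Analytic theory of L-functions for GL_n*, in *An Introduction to the Langlands
  Program* (2004), §1.1, §3.1 [CogdellAnalyticTheory2004].
* C. Mœglin, J.-L. Waldspurger, *Le spectre résiduel de GL(n)*, Ann. Sci. ÉNS 22 (1989), Appendice,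
  p. 667 [MoeglinWaldspurger1989].
-/

noncomputable section

open MeasureTheory Measure NumberField IsDedekindDomain Matrix Set ValuativeRel
open scoped MatrixGroups
open Literature.NumberTheory.GaloisRepresentations (ideleGroup)

namespace Literature.NumberTheory.Automorphic

/-! ### The dilated character -/

section Character

variable {N : ℕ} {K : Type} [Field K] [NumberField K]

/-- **`(aψ)_v = ψ_v` when `a_v = 1`.** [folklore] -/
theorem adicComponent_mulShift_of_apply_eq_one (ψ : AddChar (AdeleRing (𝓞 K) K) Circle)
    {a : AdeleRing (𝓞 K) K} {v : HeightOneSpectrum (𝓞 K)} (ha : a.2 v = 1) :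
    (ψ.mulShift a).adicComponent v = ψ.adicComponent v := by
  classical
  refine AddChar.ext _ _ fun x => ?_
  rw [AddChar.adicComponent_apply, AddChar.mulShift_apply, AddChar.adicComponent_apply]
  refine congrArg ψ (Prod.ext ?_ ?_)
  · change a.1 * (adeleSingleHom K v x).1 = (adeleSingleHom K v x).1
    rw [adeleSingleHom_apply_fst, mul_zero]
  · change a.2 * (adeleSingleHom K v x).2 = (adeleSingleHom K v x).2
    rw [adeleSingleHom_apply_snd]
    refine FiniteAdeleRing.ext K fun w => ?_
    change a.2 w * finiteAdeleSingleHom K v x w = finiteAdeleSingleHom K v x w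
    by_cases hw : w = v
    · subst hw
      rw [ha, one_mul]
    · rw [finiteAdeleSingleHom_apply_of_ne K v _ hw, mul_zero]

/-- Spread bi-equivariance at `v` only sees the local component `ψ_v`. [folklore] -/
theorem IsSpreadWhittakerAt.of_adicComponent_eq {v : HeightOneSpectrum (𝓞 K)}
    {ψ ψ₁ : AddChar (AdeleRing (𝓞 K) K) Circle} (h : ψ₁.adicComponent v = ψ.adicComponent v)
    {t : Fin N → (v.adicCompletion K)ˣ} {M : ℤ} {W : GL (Fin N) (AdeleRing (𝓞 K) K) → ℂ}
    (hW : IsSpreadWhittakerAt v ψ t M W) : IsSpreadWhittakerAt v ψ₁ t M W :=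
  ⟨fun u hu hbd g => by rw [h]; exact hW.right u hu hbd g, hW.level⟩

/-- Spread bi-equivariance (a condition on RIGHT translates) passes to left translates. [folklore] -/
theorem IsSpreadWhittakerAt.comp_mul_left {v : HeightOneSpectrum (𝓞 K)}
    {ψ : AddChar (AdeleRing (𝓞 K) K) Circle} {t : Fin N → (v.adicCompletion K)ˣ} {M : ℤ}
    {W : GL (Fin N) (AdeleRing (𝓞 K) K) → ℂ} (hW : IsSpreadWhittakerAt v ψ t M W)
    (D : GL (Fin N) (AdeleRing (𝓞 K) K)) : IsSpreadWhittakerAt v ψ t M fun g => W (D * g) :=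
  ⟨fun u hu hbd g => by simp only [← mul_assoc]; exact hW.right u hu hbd (D * g),
    fun κ hκ hκ' g => by simp only [← mul_assoc]; exact hW.level κ hκ hκ' (D * g)⟩

/-- **The superdiagonal of `diag(d) u diag(d)⁻¹`** for a diagonal `d` with constant ratios
`d_i d_{i+1}⁻¹ = a`: `Σ_i (d u d⁻¹)_{i,i+1} = a Σ_i u_{i,i+1}`. [folklore] -/
theorem superdiagSum_unipotentDiagConj_of_ratio (d : Fin N → ideleGroup K) (a : ideleGroup K)
    (hd : ∀ i j : Fin N, (i : ℕ) + 1 = j → d i * (d j)⁻¹ = a) (u : ↥(adelicUnipotent N K)) :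
    superdiagSum (unipotentDiagConj d u) = (a : AdeleRing (𝓞 K) K) * superdiagSum u := by
  rw [superdiagSum_def, superdiagSum_def, Finset.mul_sum]
  refine Finset.sum_congr rfl fun i _ => ?_
  rw [Finset.mul_sum]
  refine Finset.sum_congr rfl fun j _ => ?_
  split_ifs with hij
  · rw [coe_unipotentDiagConj, coe_glDiagonal_mul_mul_glDiagonal_inv_apply, mul_right_comm, ← Units.val_mul, hd i j hij]
  · rw [mul_zero]

/-- **`ψ_N(diag(d) u diag(d)⁻¹) = (aψ)_N(u)`** for a diagonal `d` with constant ratios `a`.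
[cite: CogdellAnalyticTheory2004, §3.1] -/
theorem whittakerCharFun_unipotentDiagConj_of_ratio (ψ : AddChar (AdeleRing (𝓞 K) K) Circle)
    (d : Fin N → ideleGroup K) (a : ideleGroup K) (hd : ∀ i j : Fin N, (i : ℕ) + 1 = j → d i * (d j)⁻¹ = a)
    (u : ↥(adelicUnipotent N K)) :
    whittakerCharFun ψ (unipotentDiagConj d u) = whittakerCharFun (ψ.mulShift (a : AdeleRing (𝓞 K) K)) u := by
  rw [whittakerCharFun_apply, whittakerCharFun_apply, AddChar.mulShift_apply, superdiagSum_unipotentDiagConj_of_ratio d a hd]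

/-- **Left `N(𝔸)`-equivariance of a torus translate.** If `W(u g) = ψ_N(u) W(g)` and `d` has constant
ratios `a`, then `W^d(g) = W(diag(d) g)` satisfies `W^d(u g) = (aψ)_N(u) W^d(g)`.
[cite: CogdellAnalyticTheory2004, §3.1] -/
theorem translate_unipotent_mul_eq {ψ : AddChar (AdeleRing (𝓞 K) K) Circle} {W : GL (Fin N) (AdeleRing (𝓞 K) K) → ℂ}
    (hWN : ∀ (u : ↥(adelicUnipotent N K)) (g : GL (Fin N) (AdeleRing (𝓞 K) K)),
      W ((u : GL (Fin N) (AdeleRing (𝓞 K) K)) * g) = whittakerCharFun ψ u * W g)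
    (d : Fin N → ideleGroup K) (a : ideleGroup K) (hd : ∀ i j : Fin N, (i : ℕ) + 1 = j → d i * (d j)⁻¹ = a)
    (u : ↥(adelicUnipotent N K)) (g : GL (Fin N) (AdeleRing (𝓞 K) K)) :
    W (glDiagonal N (AdeleRing (𝓞 K) K) d * ((u : GL (Fin N) (AdeleRing (𝓞 K) K)) * g)) =
      whittakerCharFun (ψ.mulShift (a : AdeleRing (𝓞 K) K)) u * W (glDiagonal N (AdeleRing (𝓞 K) K) d * g) := by
  have hconj : glDiagonal N (AdeleRing (𝓞 K) K) d * ((u : GL (Fin N) (AdeleRing (𝓞 K) K)) * g) =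
      ((unipotentDiagConj d u : ↥(adelicUnipotent N K)) : GL (Fin N) (AdeleRing (𝓞 K) K)) *
        (glDiagonal N (AdeleRing (𝓞 K) K) d * g) := by
    rw [coe_unipotentDiagConj]; group
  rw [hconj, hWN, whittakerCharFun_unipotentDiagConj_of_ratio ψ d a hd]

end Character

/-! ### The torus of Whittaker shifts off `S` -/

section Shift

variable (n : ℕ) (K : Type) [Field K] [NumberField K]

variable {K} in
/-- The `v`-component of the finite idele `ι_v(x)` is `x`. [folklore] -/
private theorem finiteAdeleEval_uniformizerIdele_self' (v : HeightOneSpectrum (𝓞 K)) (x : (v.adicCompletion K)ˣ) :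
    AdelicGroupData.finiteAdeleEval K v (uniformizerIdele K v x : FiniteAdeleRing (𝓞 K) K) = x := by
  rw [AdelicGroupData.finiteAdeleEval_apply, uniformizerIdele_apply_self]

variable {K} in
/-- The `w`-component of the finite idele `ι_v(x)` is `1` for `w ≠ v`. [folklore] -/
private theorem finiteAdeleEval_uniformizerIdele_of_ne' {v w : HeightOneSpectrum (𝓞 K)} (h : w ≠ v)
    (x : (v.adicCompletion K)ˣ) :
    AdelicGroupData.finiteAdeleEval K w (uniformizerIdele K v x : FiniteAdeleRing (𝓞 K) K) = 1 := by
  rw [AdelicGroupData.finiteAdeleEval_apply, uniformizerIdele_apply_of_ne K v x h]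

set_option maxHeartbeats 800000 in
/-- **The torus of Whittaker shifts off a finite set `S` of places.** For every number field `K`,
every `n` and every finite set `S` of finite places there are `τ_f ∈ (𝔸_K^{∞,×})ⁿ` and a finite idele
`a_f` such that `τ = (1, τ_f)` has last entry `1`; all consecutive ratios `τ_{f,i} τ_{f,i+1}⁻¹` equal
`a_f`; the components of `a_f` at the places of `S` are `1`; the components of every `τ_{f,i}` are
`1` at the places of `S` and at the places not dividing the different, so that `diag(τ)_v = 1` there;
and at every `v ∉ S`, `diag(τ)_v = diag(d)` with constant ratios `d_i d_{i+1}⁻¹ = a_v` for which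
`ψ_{K,v}(a_v ·)` has conductor `𝒪_v`: at `v ∣ 𝔡_K`, `v ∉ S` the Whittaker shift
`diag(ϖ_v^{-e_v(n-1)}, …, 1)`, `e_v` the conductor exponent of `ψ_{K,v}` (`AddChar.exists_shiftedConductor`),
elsewhere the identity (`adicComponent_adeleAddChar_unramified`).
[cite: CogdellAnalyticTheory2004, §3.1] [cite: CasselsFrohlichANT1967, Ch. XV (Tate), Lemma 2.2.2] -/
theorem exists_whittakerShiftTorus_outside (S : Finset (HeightOneSpectrum (𝓞 K))) :
    ∃ (τf : Fin n → (FiniteAdeleRing (𝓞 K) K)ˣ) (af : (FiniteAdeleRing (𝓞 K) K)ˣ),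
      lastEntry (fun i => Units.map (MonoidHom.inr (InfiniteAdeleRing K) (FiniteAdeleRing (𝓞 K) K) :
          FiniteAdeleRing (𝓞 K) K →* AdeleRing (𝓞 K) K) (τf i)) = 1 ∧
      (∀ i j : Fin n, (i : ℕ) + 1 = j → τf i * (τf j)⁻¹ = af) ∧
      (∀ v ∈ S, AdelicGroupData.finiteAdeleEval K v (af : FiniteAdeleRing (𝓞 K) K) = 1) ∧
      (∀ v : HeightOneSpectrum (𝓞 K), (v ∈ S ∨ ¬ v.asIdeal ∣ differentIdeal ℤ (𝓞 K)) →
        localComponent v (glDiagonal n (AdeleRing (𝓞 K) K) fun i =>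
            Units.map (MonoidHom.inr (InfiniteAdeleRing K) (FiniteAdeleRing (𝓞 K) K) :
              FiniteAdeleRing (𝓞 K) K →* AdeleRing (𝓞 K) K) (τf i)) = 1) ∧
      ∀ v ∉ S, ∃ (d : Fin n → (v.adicCompletion K)ˣ) (a : (v.adicCompletion K)ˣ),
        localComponent v (glDiagonal n (AdeleRing (𝓞 K) K) fun i =>
            Units.map (MonoidHom.inr (InfiniteAdeleRing K) (FiniteAdeleRing (𝓞 K) K) :
              FiniteAdeleRing (𝓞 K) K →* AdeleRing (𝓞 K) K) (τf i)) =
          diagonalGL (Fin n) (v.adicCompletion K) d ∧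
        (∀ i j : Fin n, (i : ℕ) + 1 = j →
          (d i : v.adicCompletion K) * ((d j)⁻¹ : (v.adicCompletion K)ˣ) = a) ∧
        (∀ c ∈ 𝒪[v.adicCompletion K], (adeleAddChar K).adicComponent v (a * c) = 1) ∧
        ∀ ϖ : v.adicCompletion K, Valued.v ϖ = WithZero.exp (-1 : ℤ) →
          ∃ c ∈ 𝒪[v.adicCompletion K], (adeleAddChar K).adicComponent v (a * (ϖ⁻¹ * c)) ≠ 1 := by
  classical
  -- a normalised uniformizer and the shifted conductor exponent of `ψ_{K,v}` at every finite place
  have hψ𝒪 : ∀ (v : HeightOneSpectrum (𝓞 K)), ∀ c ∈ 𝒪[v.adicCompletion K],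
      (adeleAddChar K).adicComponent v c = 1 := fun v c hc =>
    adeleAddCharAt_eq_one_of_mem K v
      ((HeightOneSpectrum.mem_adicCompletionIntegers _ _ _).2 ((mem_integer_adicCompletion_iff K v).1 hc))
  have hunif : ∀ v : HeightOneSpectrum (𝓞 K), ∃ ϖ : (v.adicCompletion K)ˣ,
      Valued.v (ϖ : v.adicCompletion K) = WithZero.exp (-1 : ℤ) := fun v => by
    obtain ⟨π, -, hπ⟩ := exists_coe_valued_eq_exp_neg_one v
    have hπ0 : (π : v.adicCompletion K) ≠ 0 := by
      intro h; rw [h, map_zero] at hπ; exact WithZero.exp_ne_zero hπ.symm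
    exact ⟨Units.mk0 _ hπ0, hπ⟩
  choose ϖ hϖ using hunif
  have hcond : ∀ v : HeightOneSpectrum (𝓞 K), ∃ e : ℕ,
      (∀ c ∈ 𝒪[v.adicCompletion K],
        (adeleAddChar K).adicComponent v (((ϖ v : v.adicCompletion K))⁻¹ ^ e * c) = 1) ∧
      ∃ c ∈ 𝒪[v.adicCompletion K],
        (adeleAddChar K).adicComponent v (((ϖ v : v.adicCompletion K))⁻¹ ^ e *
          (((ϖ v : v.adicCompletion K))⁻¹ * c)) ≠ 1 := fun v =>
    AddChar.exists_shiftedConductor (isUniformizingElement_of_valued_eq K v (hϖ v)) (hψ𝒪 v)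
      (adicComponent_adeleAddChar_ne_one v)
  choose e he he' using hcond
  -- the places above the different OUTSIDE `S`
  set D : Finset (HeightOneSpectrum (𝓞 K)) := (finite_setOf_dvd_differentIdeal (K := K)).toFinset \ S with hD
  have hDmem : ∀ {v}, v ∈ D ↔ v.asIdeal ∣ differentIdeal ℤ (𝓞 K) ∧ v ∉ S := fun {v} => by
    rw [hD, Finset.mem_sdiff, Set.Finite.mem_toFinset]
    rfl
  -- the torus element and the ratio idele
  set τf : Fin n → (FiniteAdeleRing (𝓞 K) K)ˣ := fun i =>
    ∏ w ∈ D, uniformizerIdele K w (ϖ w)⁻¹ ^ (e w * (n - 1 - (i : ℕ))) with hτf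
  set af : (FiniteAdeleRing (𝓞 K) K)ˣ := ∏ w ∈ D, uniformizerIdele K w (ϖ w)⁻¹ ^ (e w) with haf
  -- their local components (value level)
  have hval : ∀ (v : HeightOneSpectrum (𝓞 K)) (i : Fin n),
      AdelicGroupData.finiteAdeleEval K v (τf i : FiniteAdeleRing (𝓞 K) K) =
        if v ∈ D then (((ϖ v : v.adicCompletion K))⁻¹) ^ (e v * (n - 1 - (i : ℕ))) else 1 := by
    intro v i
    simp only [hτf, Units.coe_prod, Units.val_pow_eq_pow_val, map_prod, map_pow]
    split_ifs with hv
    · rw [Finset.prod_eq_single v (fun w _ hw => by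
          rw [finiteAdeleEval_uniformizerIdele_of_ne' (Ne.symm hw), one_pow]) (fun h => (h hv).elim),
        finiteAdeleEval_uniformizerIdele_self', Units.val_inv_eq_inv_val]
    · exact Finset.prod_eq_one fun w hw => by
        rw [finiteAdeleEval_uniformizerIdele_of_ne' (fun h => hv (by rw [h]; exact hw)), one_pow]
  have hvala : ∀ v : HeightOneSpectrum (𝓞 K),
      AdelicGroupData.finiteAdeleEval K v (af : FiniteAdeleRing (𝓞 K) K) =
        if v ∈ D then (((ϖ v : v.adicCompletion K))⁻¹) ^ (e v) else 1 := by
    intro v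
    simp only [haf, Units.coe_prod, Units.val_pow_eq_pow_val, map_prod, map_pow]
    split_ifs with hv
    · rw [Finset.prod_eq_single v (fun w _ hw => by
          rw [finiteAdeleEval_uniformizerIdele_of_ne' (Ne.symm hw), one_pow]) (fun h => (h hv).elim),
        finiteAdeleEval_uniformizerIdele_self', Units.val_inv_eq_inv_val]
    · exact Finset.prod_eq_one fun w hw => by
        rw [finiteAdeleEval_uniformizerIdele_of_ne' (fun h => hv (by rw [h]; exact hw)), one_pow]
  set τ : Fin n → ideleGroup K := fun i =>
    Units.map (MonoidHom.inr (InfiniteAdeleRing K) (FiniteAdeleRing (𝓞 K) K) :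
      FiniteAdeleRing (𝓞 K) K →* AdeleRing (𝓞 K) K) (τf i) with hτ
  have hentry : ∀ (v : HeightOneSpectrum (𝓞 K)) (i : Fin n),
      AdelicGroupData.adeleEval K v (τ i : AdeleRing (𝓞 K) K) =
        if v ∈ D then (((ϖ v : v.adicCompletion K))⁻¹) ^ (e v * (n - 1 - (i : ℕ))) else 1 := fun v i => by
    rw [← hval v i]
    rfl
  -- the local component of `diag(τ)` is the diagonal matrix of the local components
  have hcomp : ∀ (v : HeightOneSpectrum (𝓞 K)) (d : Fin n → (v.adicCompletion K)ˣ),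
      (∀ i, (d i : v.adicCompletion K) =
        if v ∈ D then (((ϖ v : v.adicCompletion K))⁻¹) ^ (e v * (n - 1 - (i : ℕ))) else 1) →
      localComponent v (glDiagonal n (AdeleRing (𝓞 K) K) τ) = diagonalGL (Fin n) (v.adicCompletion K) d := by
    intro v d hd
    ext i j
    rw [localComponent, Matrix.GeneralLinearGroup.map_apply, coe_glDiagonal, coe_diagonalGL, Matrix.diagonal_apply,
      Matrix.diagonal_apply]
    split_ifs with hij
    · subst hij
      rw [hentry, hd]
    · rw [map_zero]
  -- off `D` the local component is trivial
  have hone : ∀ v ∉ D, localComponent v (glDiagonal n (AdeleRing (𝓞 K) K) τ) = 1 := fun v hv => by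
    rw [hcomp v (fun _ => 1) fun i => by rw [if_neg hv, Units.val_one]]
    ext i j
    rw [coe_diagonalGL, Matrix.diagonal_apply, Units.val_one, Units.val_one, Matrix.one_apply]
  refine ⟨τf, af, ?_, fun i j hij => ?_, fun v hv => ?_, fun v hv => hone v fun h => ?_, fun v hvS => ?_⟩
  · -- last entry
    show lastEntry τ = 1
    unfold lastEntry
    split_ifs with h0
    · have : τf ⟨n - 1, Nat.sub_lt h0 one_pos⟩ = 1 := by
        simp only [hτf]
        exact Finset.prod_eq_one fun w _ => by
          rw [show n - 1 - (n - 1) = 0 from Nat.sub_self _, mul_zero, pow_zero]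
      show Units.map _ (τf ⟨n - 1, Nat.sub_lt h0 one_pos⟩) = 1
      rw [this]
      exact map_one _
    · rfl
  · -- constant ratios
    have hexp : ∀ w, e w * (n - 1 - (i : ℕ)) = e w * (n - 1 - (j : ℕ)) + e w := fun w => by
      have := j.2
      rw [← mul_add_one]
      congr 1
      omega
    simp only [hτf, haf, ← Finset.prod_inv_distrib, ← Finset.prod_mul_distrib]
    refine Finset.prod_congr rfl fun w _ => ?_
    rw [hexp w, pow_add, mul_comm _ (_ ^ e w), mul_assoc, mul_inv_cancel, mul_one]
  · -- `a_v = 1` on `S`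
    rw [hvala, if_neg (fun h => (hDmem.1 h).2 hv)]
  · -- trivial components on `S` and off the different
    rcases hv with hv | hv
    · exact (hDmem.1 h).2 hv
    · exact hv (hDmem.1 h).1
  · by_cases hv : v ∈ D
    · -- above the different, outside `S`: the Whittaker shift
      refine ⟨fun i => (ϖ v)⁻¹ ^ (e v * (n - 1 - (i : ℕ))), (ϖ v)⁻¹ ^ e v, hcomp v _ fun i => ?_,
        fun i j hij => ?_, fun c hc => ?_, fun ϖ' hϖ' => ?_⟩
      · rw [if_pos hv, Units.val_pow_eq_pow_val, Units.val_inv_eq_inv_val]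
      · have h := whittakerShift_ratio (n := n) (Units.ne_zero (ϖ v)) (e v) i j hij
        simp only [Units.mk0_val] at h
        exact h
      · rw [Units.val_pow_eq_pow_val, Units.val_inv_eq_inv_val]
        exact he v c hc
      · obtain ⟨c, hc, hne⟩ := he' v
        have hϖ'0 : ϖ' ≠ 0 := by
          intro h; rw [h, map_zero] at hϖ'; exact WithZero.exp_ne_zero hϖ'.symm
        refine ⟨ϖ' * ((ϖ v : v.adicCompletion K))⁻¹ * c, ?_, ?_⟩
        · rw [mem_integer_adicCompletion_iff, map_mul, map_mul, map_inv₀, hϖ', hϖ v,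
            mul_inv_cancel₀ WithZero.exp_ne_zero, one_mul]
          exact (mem_integer_adicCompletion_iff K v).1 hc
        · rw [Units.val_pow_eq_pow_val, Units.val_inv_eq_inv_val, ← mul_assoc ϖ'⁻¹, ← mul_assoc ϖ'⁻¹,
            inv_mul_cancel₀ hϖ'0, one_mul]
          exact hne
    · -- off the different (and outside `S`): the identity, `ψ_{K,v}` has conductor `𝒪_v`
      have hvD : ¬ v.asIdeal ∣ differentIdeal ℤ (𝓞 K) := fun h => hv (hDmem.2 ⟨h, hvS⟩)
      obtain ⟨h1, h2⟩ := adicComponent_adeleAddChar_unramified (K := K) hvD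
      refine ⟨fun _ => 1, 1, hcomp v _ fun i => by rw [if_neg hv, Units.val_one],
        fun i j _ => by rw [inv_one, Units.val_one, mul_one], fun c hc => ?_, fun ϖ' hϖ' => ?_⟩
      · rw [Units.val_one, one_mul]; exact h1 c hc
      · obtain ⟨c, hc, hne⟩ := h2 ϖ' hϖ'
        exact ⟨c, hc, by rwa [Units.val_one, one_mul]⟩

end Shift

end Literature.NumberTheory.Automorphic
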